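import Summits.BirchSwinnertonDyer.BirchSwinnertonDyer.Theorems.PrintCf2RubinValueTwoCMDivisionTowerScalars
import Summits.BirchSwinnertonDyer.BirchSwinnertonDyer.Theorems.PrintCf2SplitBadTwoAvatarRigidity
import Summits.BirchSwinnertonDyer.BirchSwinnertonDyer.Theorems.PrintCf2RubinValueTwoFrameSeedDyadicEmbedding
import Literature.NumberTheory.EllipticCurves.ComplexMultiplicationDeuringGaloisActionProofs
import Literature.NumberTheory.GaloisRepresentations.LocalOneUnitsProofs
import HarnessLib

/-!
# Division-tower alignment, file 2: THE AVATAR ↔ COMPONENT BRIDGE (L) — the `ι`-adic avatar `r` of the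
# Grössencharacter `ψ` ACTS ON THE DEURING COMPONENT `E[v^∞]`: `σ • g = a • g` on `E[v^∞][2^j] = ℤ·g` forces
# `a ≡ χ(σ)⁻¹ (mod 2^j)` for EVERY `σ ∈ Γ_K` (`χ` the `ℤ₂ˣ`-valued entry of `r`)

Cell `bsd-print-cf2`, width seat `bsd-line-cf2-p1-w8` g7; `--supports` stmt-BirchSwinnertonDyer-23300 (helper).  Second file of
the DIVISION-TOWER ALIGNMENT residual (T-a)–(T-d) of LEAD's v2.6 `stub_towerDescentT1` (hypotheses of -w7 g9's p736536).  WHY IT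
IS NEEDED: the class door pins the quadratic character `θ` on `Υ = Gal(K̄/K̃_∞)` ONLY through the avatar `r′` of the dictionary's
`ψ′` (junction `unitChar θ υ = r′(υ)`), while the division tower `K(W′_K[4·2ⁿ])` is cut out by the Galois action on the torsion;
(L) identifies the two.  INPUTS, all tree theorems/predicates: the Deuring split print's component predicate
`DeuringGaloisAction.IsPrimaryComponent W 2 ψ v M` (clause (frob): an arithmetic Frobenius at `𝔔 ∣ 𝔮`, `𝔮 ≠ v` unramified, acts
on `M` as the generator `a_𝔮 ∈ 𝓞_K` of `𝔮` with `w(a_𝔮) = ψ(ϖ_𝔮)`, modulo powers of `v`), the avatar predicate `IsPAdicAvatarOf ι ψ r`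
(GEOMETRIC normalisation: the Frobenius entry is `ι⁻¹(ψ(ϖ_𝔮))⁻¹`, -w4 g7 `AvatarRigidity.entry_eq_of_isPAdicAvatarOf` — hence the
INVERSE), the `ℤ₂ˣ`-valued entry `χ` (-w4 g7 `exists_padicIntUnitsChar_of_isPAdicAvatarOf` shape), cruxlead-23721 g3's dyadic embedding
`φ₀ : 𝓞 K →+* ℤ₂` behind `ι⁻¹ ∘ w` detecting `v` (`FrameSeed.exists_intEmb`, `mem_iff_two_dvd_of_norm`, `toZModPow_eq_iff_sub_mem_pow`
at an unramified `v`: `ord_v 2 = 1`), file 1 (scalars), and Frobenius DENSITY (`absoluteGaloisGroup.frobenius_dense` on the tree's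
PROVED Chebotarev `Automorphic.chebotarev_artinRep_holds`) with `OneUnits.continuous_toZModPow`.

* §1 `toZModPow_inv_eq_of_entry_eq` — bookkeeping: `r(σ)₀₀ = (ι⁻¹ w a)⁻¹` and `r(σ)₀₀ = χ(σ)` give `χ(σ)⁻¹ = φ₀ a` in `ℤ₂`.
* §2 ★ `intCast_eq_toZModPow_inv_of_isArithFrobAt` — (L) at an arithmetic Frobenius above an unramified odd `𝔮`.
* §3 `continuous_scalarMod` (the scalar of `σ` on `ℤ·g` mod `2^j` is locally constant: constant on the cosets of the open
  `Γ_{K(E[2^j])}`), ★★ `intCast_eq_toZModPow_inv` — **(L) for every `σ ∈ Γ_K`** (closed equaliser ⊇ dense Frobenius set), and the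
  sign corollary `smul_generator_eq_self_iff_toZModPow_eq_one` / `…_eq_neg_iff_…`.

THEOREMS ONLY (no `def`, no named fact, no `sorry`); Theses-free.  HONEST FRAMING: conditional only on its displayed hypotheses
(a component with the printed properties — supplied in the line by the cite stub's Deuring split print —, an avatar, the embedding);
closes nothing by itself; beyond-print theorem: no (Serre 1968 II §2.7 / Rubin LNM 1716 Thm. 5.15: the `𝔭`-adic Tate module of a
CM curve is the avatar of `ψ`).  No summit statement is proved by this seat; BSD is not proved by any of this.

## References
* [Rubin1999] K. Rubin, LNM 1716 (1999), §5 Thm. 5.15 (ii), Cor. 5.16 (i)–(ii) (Frobenius acts on `E[𝔭^k]` as `ψ(𝔮)`).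
* [SerreAbelianLadic1968] J.-P. Serre, *Abelian ℓ-adic representations and elliptic curves* (1968), Ch. I §2.2 Cor. 2 (a), §2.3;
  Ch. II §2.7 (the `ℓ`-adic avatar of an algebraic Hecke character).
* [CastellaHsieh2018] F. Castella, M.-L. Hsieh, §3.3 (the avatar `φ̂` as a Galois character, geometric normalisation).
-/

-- the summit namespace `Summit.BirchSwinnertonDyer.BirchSwinnertonDyer` repeats the problem name by design (D-0017)
set_option linter.dupNamespace false
set_option autoImplicit false

noncomputable section

open scoped Classical

open Field NumberField IsDedekindDomain WeierstrassCurve Literature.NumberTheory.EllipticCurves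
  Literature.NumberTheory.EllipticCurves.DeuringGaloisAction Literature.NumberTheory.GaloisRepresentations
open Summit.BirchSwinnertonDyer.BirchSwinnertonDyer.Theorems.PrintCf2.AvatarRigidity (entry_eq_of_isPAdicAvatarOf
  eventually_notMem_and_isUnramifiedAt)

namespace Summit.BirchSwinnertonDyer.BirchSwinnertonDyer.Theorems.PrintCf2.CMDivisionTower

variable {K : Type} [Field K] [NumberField K]

/-! ## §1. Bookkeeping in `ℤ₂ ⊂ ℚ₂ ⊂ ℚ̄₂`: the entry, its inverse, and the embedding `φ₀` -/

/-- If `χ(σ) = (φ₀ a)⁻¹` after `ℤ₂ ⊂ ℚ₂ ⊂ ℚ̄₂` then `χ(σ)⁻¹ = φ₀ a` in `ℤ₂`. [folklore] -/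
theorem units_inv_eq_of_algebraMap_eq_inv {u : ℤ_[2]ˣ} {b : ℤ_[2]}
    (h : algebraMap ℚ_[2] (PadicAlgCl 2) (((u : ℤ_[2]) : ℚ_[2])) = (algebraMap ℚ_[2] (PadicAlgCl 2) ((b : ℤ_[2]) : ℚ_[2]))⁻¹) :
    ((u⁻¹ : ℤ_[2]ˣ) : ℤ_[2]) = b := by
  have hinj : Function.Injective (algebraMap ℚ_[2] (PadicAlgCl 2)) := (algebraMap ℚ_[2] (PadicAlgCl 2)).injective
  have hb : (b : ℚ_[2]) ≠ 0 := by
    intro hb0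
    rw [hb0, map_zero, inv_zero, ← map_zero (algebraMap ℚ_[2] (PadicAlgCl 2))] at h
    have hu0 : ((u : ℤ_[2]) : ℚ_[2]) = 0 := hinj h
    exact (Units.ne_zero u) (PadicInt.ext (by rw [hu0, PadicInt.coe_zero]))
  rw [← map_inv₀] at h
  have h' : ((u : ℤ_[2]) : ℚ_[2]) = ((b : ℤ_[2]) : ℚ_[2])⁻¹ := hinj h
  have hmul : ((u : ℤ_[2]) : ℚ_[2]) * ((b : ℤ_[2]) : ℚ_[2]) = 1 := by rw [h', inv_mul_cancel₀ hb]
  have hmul' : (u : ℤ_[2]) * b = 1 := PadicInt.ext (by rw [PadicInt.coe_mul, PadicInt.coe_one]; exact hmul)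
  exact Units.inv_eq_of_mul_eq_one_right hmul'

/-- In a commutative monoid with `a * b = 1`: `b = 1 ↔ a = 1`. [folklore] -/
theorem eq_one_iff_eq_one_of_mul_eq_one {R : Type*} [CommRing R] {a b : R} (h : a * b = 1) : b = 1 ↔ a = 1 :=
  ⟨fun hb ↦ by rw [hb, mul_one] at h; exact h, fun ha ↦ by rw [ha, one_mul] at h; exact h⟩

/-- In a commutative ring with `a * b = 1`: `b = -1 ↔ a = -1`. [folklore] -/
theorem eq_neg_one_iff_eq_neg_one_of_mul_eq_one {R : Type*} [CommRing R] {a b : R} (h : a * b = 1) :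
    b = -1 ↔ a = -1 :=
  ⟨fun hb ↦ by rw [hb, mul_neg_one, neg_eq_iff_eq_neg] at h; exact h,
    fun ha ↦ by rw [ha, neg_one_mul, neg_eq_iff_eq_neg] at h; exact h⟩

omit [NumberField K] in
/-- Reduction of an integer through `φ₀`: `toZModPow j (φ₀ N) = N`. [folklore] -/
theorem toZModPow_intEmb_intCast (φ₀ : 𝓞 K →+* ℤ_[2]) (j : ℕ) (N : ℤ) :
    PadicInt.toZModPow j (φ₀ (N : 𝓞 K)) = (N : ZMod (2 ^ j)) := by
  rw [map_intCast, map_intCast]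

/-- The canonical integer representative: `N := (toZModPow j x).val` reduces to `toZModPow j x`. [folklore] -/
theorem intCast_val_toZModPow (j : ℕ) (x : ℤ_[2]) :
    (((PadicInt.toZModPow j x).val : ℤ) : ZMod (2 ^ j)) = PadicInt.toZModPow j x := by
  rw [Int.cast_natCast, ZMod.natCast_zmod_val]

/-! ## §2. (L) at an arithmetic Frobenius -/

section Link

variable (W : WeierstrassCurve K) {ψ : HeckeCharacter K} {v : HeightOneSpectrum (𝓞 K)}
  {M : AddSubgroup (geomPrimaryTorsion W 2)} (hM : IsPrimaryComponent W 2 ψ v M) (hv : ((2 : ℕ) : 𝓞 K) ∈ v.asIdeal)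
  (ι : PadicAlgCl 2 ≃+* ℂ) {r : FramedGaloisRep K (PadicAlgCl 2) 1} (hr : IsPAdicAvatarOf ι ψ r)
  {χ : absoluteGaloisGroup K →ₜ* ℤ_[2]ˣ}
  (hχ : ∀ σ : absoluteGaloisGroup K, (((r σ : GL (Fin 1) (PadicAlgCl 2)) : Matrix (Fin 1) (Fin 1) (PadicAlgCl 2)) 0 0) =
    algebraMap ℚ_[2] (PadicAlgCl 2) (((χ σ : ℤ_[2]ˣ) : ℤ_[2]) : ℚ_[2]))
  (w : InfinitePlace K) {φ₀ : 𝓞 K →+* ℤ_[2]}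
  (hφ₀ : ∀ k : 𝓞 K, algebraMap ℚ_[2] (PadicAlgCl 2) ((φ₀ k : ℤ_[2]) : ℚ_[2]) = ι.symm (w.embedding (k : K)))
  (hφv : ∀ k : 𝓞 K, k ∈ v.asIdeal ↔ (2 : ℤ_[2]) ∣ φ₀ k)
  (h2v : v.intValuation (2 : 𝓞 K) = WithZero.exp (-1 : ℤ))

include hM hv hr hχ hφ₀ hφv h2v in
/-- ★ **(L) at a Frobenius.** `σ` an arithmetic Frobenius at `𝔔 ∣ 𝔮`, `𝔮 ∤ 2`, `ψ` unramified at `𝔮`; if `σ • g = a • g` on the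
generator `g` of `E[v^∞][2^j]` (order `2^j`), then `a ≡ χ(σ)⁻¹ (mod 2^j)`: Deuring (frob) gives `σ = a_𝔮` on `E[v^k]`, the avatar gives
`χ(σ) = ι⁻¹(ψ(ϖ_𝔮))⁻¹ = (ι⁻¹ w a_𝔮)⁻¹ = (φ₀ a_𝔮)⁻¹`, and `a_𝔮 ≡ N (mod v^j)` iff `φ₀ a_𝔮 ≡ N (mod 2^j)`.
[cite: Rubin1999, §5 Thm. 5.15 (ii), Cor. 5.16 (i)–(ii)] [cite: SerreAbelianLadic1968, Ch. II §2.7] [cite: CastellaHsieh2018, §3.3] -/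
theorem intCast_eq_toZModPow_inv_of_isArithFrobAt {𝔮 : HeightOneSpectrum (𝓞 K)} (h2𝔮 : ((2 : ℕ) : 𝓞 K) ∉ 𝔮.asIdeal)
    (hunr : ψ.IsUnramifiedAt 𝔮) {𝔔 : Ideal (absIntegers (𝓞 K) K)} (h𝔔 : 𝔔 ∈ 𝔮.primesAbove)
    {σ : absoluteGaloisGroup K} (hσ : IsArithFrobAt (𝓞 K) σ 𝔔)
    {j : ℕ} {g : geomPrimaryTorsion W 2} (hg : M ⊓ AddSubgroup.torsionBy (geomPrimaryTorsion W 2) (2 ^ j) = AddSubgroup.zmultiples g)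
    (hord : addOrderOf g = 2 ^ j) {a : ℤ} (ha : σ • g = a • g) :
    (a : ZMod (2 ^ j)) = PadicInt.toZModPow j ((χ σ)⁻¹ : ℤ_[2]ˣ) := by
  have hne : 𝔮 ≠ v := fun h ↦ h2𝔮 (h ▸ hv)
  obtain ⟨aq, haq, -, hact⟩ := hM.exists_generator_actsAsScalarMod hne hunr w h𝔔 hσ
  -- the avatar entry at `σ`: `χ(σ) = (φ₀ a_𝔮)⁻¹`, so `χ(σ)⁻¹ = φ₀ a_𝔮`
  have hent := entry_eq_of_isPAdicAvatarOf ι hr h2𝔮 hunr 𝔔 h𝔔 σ hσ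
  rw [hχ σ, ← haq, ← hφ₀ aq] at hent
  have hinv : (((χ σ)⁻¹ : ℤ_[2]ˣ) : ℤ_[2]) = φ₀ aq := units_inv_eq_of_algebraMap_eq_inv hent
  -- the integer representative `N ≡ a_𝔮 (mod v^j)`
  set N : ℤ := ((PadicInt.toZModPow j (φ₀ aq)).val : ℤ) with hN
  have hNred : PadicInt.toZModPow j (φ₀ (N : 𝓞 K)) = PadicInt.toZModPow j (φ₀ aq) := by
    rw [toZModPow_intEmb_intCast, hN, intCast_val_toZModPow]
  have hcong : (N : 𝓞 K) - aq ∈ v.asIdeal ^ j := (FrameSeed.toZModPow_eq_iff_sub_mem_pow hφv h2v j _ _).mp hNred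
  -- Deuring: `σ • g = N • g`
  have hgM : g ∈ M := (AddSubgroup.mem_inf.mp (generator_mem_layer W 2 hg)).1
  have hgtor : 2 ^ j • g = 0 := by
    have h := pow_zsmul_generator_eq_zero W 2 hg
    rw [← natCast_zsmul]; exact_mod_cast h
  have hσN : σ • g = N • g := hact j N hcong g hgM hgtor
  rw [intCast_eq_intCast_of_smul_eq_zsmul W 2 hord ha hσN, hinv, ← hNred, toZModPow_intEmb_intCast]

/-! ## §3. (L) everywhere, by Frobenius density -/

omit [NumberField K] in
/-- **The scalar of `σ` on a layer generator, read mod `2^j`, is a CONTINUOUS (locally constant) function of `σ`**: it is constant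
on the cosets of the open subgroup `Γ_{K(E[2^j])}` (whose elements fix `g ∈ E[2^j]`).  Here `s σ` is ANY choice of scalar
(`σ • g = s σ • g`). [cite: SilvermanAEC2009, III.§7, VIII.§1] -/
theorem continuous_intCast_scalar [CharZero K] [W.IsElliptic] {j : ℕ} {g : geomPrimaryTorsion W 2}
    (hg : M ⊓ AddSubgroup.torsionBy (geomPrimaryTorsion W 2) (2 ^ j) = AddSubgroup.zmultiples g) (hord : addOrderOf g = 2 ^ j)
    (s : absoluteGaloisGroup K → ℤ) (hs : ∀ σ, σ • g = s σ • g) :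
    Continuous fun σ ↦ (s σ : ZMod (2 ^ j)) := by
  haveI : NeZero (2 ^ j) := ⟨pow_ne_zero j two_ne_zero⟩
  refine continuous_discrete_rng.2 fun c ↦ ?_
  rw [isOpen_iff_mem_nhds]
  intro σ₀ hσ₀
  -- the open coset `σ₀ · Γ_{K(E[2^j])}` lies in the level set
  have hH := W.isOpen_fixingSubgroupOfModule_geomTorsion (2 ^ j)
  have hcont : Continuous fun σ : absoluteGaloisGroup K ↦ σ₀⁻¹ * σ := continuous_const.mul continuous_id
  have hopen : IsOpen ((fun σ : absoluteGaloisGroup K ↦ σ₀⁻¹ * σ) ⁻¹'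
      (fixingSubgroupOfModule K (geomTorsion W ((2 ^ j : ℕ) : ℤ)) : Set (absoluteGaloisGroup K))) := hH.preimage hcont
  refine Filter.mem_of_superset (hopen.mem_nhds ?_) fun σ hσ ↦ ?_
  · show σ₀⁻¹ * σ₀ ∈ fixingSubgroupOfModule K (geomTorsion W ((2 ^ j : ℕ) : ℤ))
    rw [inv_mul_cancel]; exact Subgroup.one_mem _
  · -- `τ := σ₀⁻¹ σ` fixes `g`
    have hτ : σ₀⁻¹ * σ ∈ fixingSubgroupOfModule K (geomTorsion W ((2 ^ j : ℕ) : ℤ)) := hσ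
    rw [W.mem_fixingSubgroupOfModule_geomTorsion_iff] at hτ
    have hgtor : ((2 ^ j : ℕ) : ℤ) • (g : geomPoints W) = 0 := by
      have h := pow_zsmul_generator_eq_zero W 2 hg
      have := congrArg (fun y : geomPrimaryTorsion W 2 ↦ (y : geomPoints W)) h
      rw [AddSubgroupClass.coe_zsmul, ZeroMemClass.coe_zero] at this
      exact_mod_cast this
    have hfix : (σ₀⁻¹ * σ) • g = g := by
      apply Subtype.ext
      have := congrArg (fun T : geomTorsion W ((2 ^ j : ℕ) : ℤ) ↦ (T : geomPoints W)) (hτ ⟨g, hgtor⟩)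
      simpa only [AddSubgroup.torsionBy.coe_smul, primaryComponent.coe_smul] using this
    have hσσ₀ : σ • g = s σ₀ • g := by
      rw [show σ = σ₀ * (σ₀⁻¹ * σ) by group, mul_smul, hfix, hs σ₀]
    show (s σ : ZMod (2 ^ j)) = c
    rw [← intCast_eq_intCast_of_smul_eq_zsmul W 2 hord hσσ₀ (hs σ)]
    exact hσ₀

include hM hv hr hχ hφ₀ hφv h2v in
/-- ★★ **(L): THE AVATAR ACTS ON THE COMPONENT.** For EVERY `σ ∈ Γ_K`: if `σ • g = a • g` on the generator `g` of
`E[v^∞][2^j]`, then `a ≡ χ(σ)⁻¹ (mod 2^j)` — both sides are continuous in `σ` (`continuous_intCast_scalar`,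
`OneUnits.continuous_toZModPow`) and agree on the arithmetic Frobenii above the cofinitely many odd unramified `𝔮` (§2), a DENSE set
(`absoluteGaloisGroup.frobenius_dense`, Chebotarev proved in the tree). [cite: SerreAbelianLadic1968, Ch. I §2.2 Cor. 2 (a), §2.3; Ch. II §2.7]
[cite: Rubin1999, §5 Thm. 5.15 (ii)] -/
theorem intCast_eq_toZModPow_inv [W.IsElliptic] (σ : absoluteGaloisGroup K) {j : ℕ} {g : geomPrimaryTorsion W 2}
    (hg : M ⊓ AddSubgroup.torsionBy (geomPrimaryTorsion W 2) (2 ^ j) = AddSubgroup.zmultiples g) (hord : addOrderOf g = 2 ^ j)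
    {a : ℤ} (ha : σ • g = a • g) :
    (a : ZMod (2 ^ j)) = PadicInt.toZModPow j ((χ σ)⁻¹ : ℤ_[2]ˣ) := by
  -- a global choice of scalars
  choose s hs using fun τ : absoluteGaloisGroup K ↦ exists_smul_generator_eq_zsmul W 2 hM.smul_mem hg τ
  -- the finite exceptional set
  set S : Set (HeightOneSpectrum (𝓞 K)) := {𝔮 | ¬ (((2 : ℕ) : 𝓞 K) ∉ 𝔮.asIdeal ∧ ψ.IsUnramifiedAt 𝔮)} with hS
  have hSf : S.Finite := Filter.eventually_cofinite.1 (eventually_notMem_and_isUnramifiedAt (p := 2) ψ)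
  have hdense := absoluteGaloisGroup.frobenius_dense Literature.NumberTheory.Automorphic.chebotarev_artinRep_holds K S hSf
  -- the two continuous maps to the discrete `ℤ/2^j`
  have hf : Continuous fun τ : absoluteGaloisGroup K ↦ PadicInt.toZModPow j (((χ τ)⁻¹ : ℤ_[2]ˣ) : ℤ_[2]) :=
    (OneUnits.continuous_toZModPow 2 j).comp (Units.continuous_val.comp (continuous_inv.comp χ.continuous))
  have hsc := continuous_intCast_scalar W hg hord s hs
  have hclosed : IsClosed {τ : absoluteGaloisGroup K | (s τ : ZMod (2 ^ j)) = PadicInt.toZModPow j (((χ τ)⁻¹ : ℤ_[2]ˣ) : ℤ_[2])} :=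
    isClosed_eq hsc hf
  have hsub : {τ : absoluteGaloisGroup K | ∃ 𝔮 ∉ S, ∃ 𝔔 ∈ 𝔮.primesAbove, IsArithFrobAt (𝓞 K) τ 𝔔} ⊆
      {τ | (s τ : ZMod (2 ^ j)) = PadicInt.toZModPow j (((χ τ)⁻¹ : ℤ_[2]ˣ) : ℤ_[2])} := by
    rintro τ ⟨𝔮, h𝔮, 𝔔, h𝔔, hτ⟩
    have h𝔮' : ((2 : ℕ) : 𝓞 K) ∉ 𝔮.asIdeal ∧ ψ.IsUnramifiedAt 𝔮 := by
      by_contra hc; exact h𝔮 hc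
    exact intCast_eq_toZModPow_inv_of_isArithFrobAt W hM hv ι hr hχ w hφ₀ hφv h2v h𝔮'.1 h𝔮'.2 h𝔔 hτ hg hord (hs τ)
  have huniv : Set.univ ⊆ {τ | (s τ : ZMod (2 ^ j)) = PadicInt.toZModPow j (((χ τ)⁻¹ : ℤ_[2]ˣ) : ℤ_[2])} := by
    rw [← hdense.closure_eq]
    exact hclosed.closure_subset_iff.mpr hsub
  have hσ : (s σ : ZMod (2 ^ j)) = PadicInt.toZModPow j (((χ σ)⁻¹ : ℤ_[2]ˣ) : ℤ_[2]) := huniv (Set.mem_univ σ)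
  rw [intCast_eq_intCast_of_smul_eq_zsmul W 2 hord ha (hs σ), hσ]

include hM hv hr hχ hφ₀ hφv h2v in
/-- **Sign corollary**: `σ` FIXES the generator of `E[v^∞][2^j]` iff `χ(σ) ≡ 1 (mod 2^j)`.
[cite: Rubin1999, §5 Thm. 5.15 (ii)] [cite: SerreAbelianLadic1968, Ch. II §2.7] -/
theorem smul_generator_eq_self_iff_toZModPow_eq_one [W.IsElliptic] (σ : absoluteGaloisGroup K) {j : ℕ}
    {g : geomPrimaryTorsion W 2} (hg : M ⊓ AddSubgroup.torsionBy (geomPrimaryTorsion W 2) (2 ^ j) = AddSubgroup.zmultiples g)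
    (hord : addOrderOf g = 2 ^ j) :
    σ • g = g ↔ PadicInt.toZModPow j ((χ σ : ℤ_[2]ˣ) : ℤ_[2]) = 1 := by
  obtain ⟨a, ha⟩ := exists_smul_generator_eq_zsmul W 2 hM.smul_mem hg σ
  rw [smul_generator_eq_self_iff W 2 hord ha, intCast_eq_toZModPow_inv W hM hv ι hr hχ w hφ₀ hφv h2v σ hg hord ha]
  have hmul : PadicInt.toZModPow j ((χ σ : ℤ_[2]ˣ) : ℤ_[2]) * PadicInt.toZModPow j (((χ σ)⁻¹ : ℤ_[2]ˣ) : ℤ_[2]) = 1 := by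
    rw [← map_mul, Units.mul_inv, map_one]
  exact eq_one_iff_eq_one_of_mul_eq_one hmul

include hM hv hr hχ hφ₀ hφv h2v in
/-- **Sign corollary**: `σ` NEGATES the generator of `E[v^∞][2^j]` iff `χ(σ) ≡ −1 (mod 2^j)`.
[cite: Rubin1999, §5 Thm. 5.15 (ii)] [cite: SerreAbelianLadic1968, Ch. II §2.7] -/
theorem smul_generator_eq_neg_iff_toZModPow_eq_neg_one [W.IsElliptic] (σ : absoluteGaloisGroup K) {j : ℕ}
    {g : geomPrimaryTorsion W 2} (hg : M ⊓ AddSubgroup.torsionBy (geomPrimaryTorsion W 2) (2 ^ j) = AddSubgroup.zmultiples g)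
    (hord : addOrderOf g = 2 ^ j) :
    σ • g = -g ↔ PadicInt.toZModPow j ((χ σ : ℤ_[2]ˣ) : ℤ_[2]) = -1 := by
  obtain ⟨a, ha⟩ := exists_smul_generator_eq_zsmul W 2 hM.smul_mem hg σ
  rw [smul_generator_eq_neg_iff W 2 hord ha, intCast_eq_toZModPow_inv W hM hv ι hr hχ w hφ₀ hφv h2v σ hg hord ha]
  have hmul : PadicInt.toZModPow j ((χ σ : ℤ_[2]ˣ) : ℤ_[2]) * PadicInt.toZModPow j (((χ σ)⁻¹ : ℤ_[2]ˣ) : ℤ_[2]) = 1 := by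
    rw [← map_mul, Units.mul_inv, map_one]
  exact eq_neg_one_iff_eq_neg_one_of_mul_eq_one hmul

end Link

end Summit.BirchSwinnertonDyer.BirchSwinnertonDyer.Theorems.PrintCf2.CMDivisionTower

end
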